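import Summits.QuantumFields.YangMills.Theorems.AllWindowsColdBoxGaussSideLocalMoments
import Summits.QuantumFields.YangMills.Theorems.AllWindowsColdBoxGaussSideLocal
import Summits.QuantumFields.YangMills.Theorems.AllWindowsColdBoxTiltMomentsThresholds
import Summits.QuantumFields.YangMills.Theorems.AllWindowsColdBoxLineGaussToolkit
import Summits.QuantumFields.YangMills.Theorems.ColdBoxAllGroupsBulkAllGroupsDlrPlumbingG
import Summits.QuantumFields.YangMills.Theorems.ColdBoxAllGroupsBulkAllGroupsKernelCovCoreMomentsG
import Summits.QuantumFields.YangMills.Theorems.WeakCouplingRatesColdBoxGaussMoments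
import Summits.QuantumFields.YangMills.Theorems.WeakCouplingRatesColdBoxDirichletShiftedMean
import Literature.Analysis.FunctionSpaces.SquaredBesselExistence
import Mathlib.Analysis.Convex.Integral
import Mathlib.Analysis.Convex.Mul
import HarnessLib

/-!
# LINE-17 «hypercontractive second-order tilt expansion» on crux `AllWindowsColdBox.BoxMidWindowsSU22` (stmt-QuantumFields-24003):
# F(i) of stub F `stub_gaussSideTerms` — the fourth moment of a centred plaquette observable is `O(1)` (STUB-PLAN-E §5 F(i))

`GaussSideTerms θ` (i) asks, eventually in `β` and uniformly in `T ≤ ⌈β^θ⌉`, for `(∫ (f − E_ν f)⁴ dν)^{1/4} ≤ K` and the same for `g_T`,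
where `f = obsF θ β = β·plaqCostAt ρ₂ (boxCentre H) 1 2 ∘ cfgTE`, `g_T = obsG θ β T` (the `(1,2)`-plaquette translated by `T e₀`),
`ν = lineGauss θ β`.  **`gaussSide_fourthMoment`** proves this for EVERY plaquette `(x,1,2)` touching the cold box (both `obsF` and
`obsG T` are instances by `centre_mem_plaquettesTouching`), with `K = 16·54·(840·D⁴ + 2) + 1`:

`(f − c)⁴ ≤ 8(f⁴ + c⁴)` and Jensen `c⁴ ≤ ∫f⁴dν` (`f` is bounded by `4β`, `abs_plaqCostAt_leG`); on the event `|f| ≤ |q| + |c_x| + r_x`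
(E(0) `abs_qObsD_sub_beta_mul_plaqCostAt_sub_cubic_le`: `q = qObsD`, `c_x` the local cubic term, `r_x` the quartic remainder), so
`f⁴ ≤ 27(q⁴ + c_x⁴ + r_x⁴)` `ν`-a.e.; `∫·dν ≤ 2∫·dγ` (`integral_cond_le_two_mul`); `∫q⁴dγ ≤ 840D⁴` (`integral_quadObs_pow_four_piD_le`,
Dirichlet variance `≤ 1` for touching plaquettes); `∫c_x⁴dγ, ∫r_x⁴dγ ≤ 1` eventually (`…GaussSideLocalMoments` + the thresholds
`eventually_fourthMomentThresholds` of this file).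

No definition; standard axioms.  HONEST LABEL: one third of the OPEN registered stub F of one critic-PASSed line on the R2ξ″ RECORD-rung
crux 24003; no stub by name, no crux, rung or summit; the Yang–Mills mass gap is NOT proved by this file.
-/

set_option autoImplicit false

noncomputable section

open MeasureTheory ProbabilityTheory Finset
open scoped Matrix Matrix.Norms.Frobenius
open Literature.MathematicalPhysics.QuantumLattice
open Literature.MathematicalPhysics.QuantumFieldTheory
open Literature.MathematicalPhysics.QuantumFieldTheory.LatticeMaxwell
open Summit.QuantumFields.YangMills.Theorems.WeakCouplingRates
open Summit.QuantumFields.YangMills.Theorems.ColdBoxAllGroups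
open Summit.QuantumFields.YangMills.Theorems.FreeEnergyLogCoefficient

namespace Summit.QuantumFields.YangMills.Theorems.AllWindowsColdBoxBoxMidLine

/-! ## Elementary inequalities -/

/-- `(x + y + z)⁴ ≤ 27(x⁴ + y⁴ + z⁴)` for `x, y, z ≥ 0`. -/
theorem add_add_pow_four_le {x y z : ℝ} (hx : 0 ≤ x) (hy : 0 ≤ y) (hz : 0 ≤ z) :
    (x + y + z) ^ 4 ≤ 27 * (x ^ 4 + y ^ 4 + z ^ 4) := by
  have h := pow_sum_le_card_mul_sum_pow (s := (Finset.univ : Finset (Fin 3))) (f := ![x, y, z])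
    (fun i _ => by fin_cases i <;> simp [hx, hy, hz]) 3
  simp only [Finset.card_univ, Fintype.card_fin, Nat.cast_ofNat, Fin.sum_univ_three, Matrix.cons_val_zero, Matrix.cons_val_one,
    Matrix.cons_val_two, Matrix.head_cons, Matrix.tail_cons] at h
  norm_num at h
  exact h

/-- `x^{1/4} ≤ x + 1` for `x ≥ 0`. -/
theorem rpow_quarter_le_add_one {x : ℝ} (hx : 0 ≤ x) : x ^ (1 / 4 : ℝ) ≤ x + 1 := by
  have h1 : x ≤ (x + 1) ^ 4 := by nlinarith [sq_nonneg x, sq_nonneg (x + 1), mul_nonneg hx (sq_nonneg (x + 1))]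
  calc x ^ (1 / 4 : ℝ) ≤ ((x + 1) ^ 4) ^ (1 / 4 : ℝ) := Real.rpow_le_rpow hx h1 (by norm_num)
    _ = x + 1 := by
        rw [show (1 / 4 : ℝ) = ((4 : ℕ) : ℝ)⁻¹ by norm_num]
        exact Real.pow_rpow_inv_natCast (by linarith) (by norm_num)

/-! ## Thresholds of F(i) -/

/-- **The thresholds of F(i), eventually in `β`** (`0 < θ ≤ 1/16`): the fourth moments of the local cubic term and of the quartic
remainder of one plaquette are `≤ 1` (`D = dimE ρ₂`, `H = ⌈β^θ⌉`). -/
theorem eventually_fourthMomentThresholds {θ : ℝ} (hθ : 0 < θ) (hθ16 : θ ≤ 1 / 16) :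
    ∃ β₀ : ℝ, ∀ β : ℝ, β₀ ≤ β → 1 ≤ β ∧
      6 ^ 4 * 4 ^ 12 * 10395 * (dimE ρ₂ : ℝ) ^ 6 * (16 * (⌈β ^ θ⌉₊ : ℝ)) ^ 6 / β ^ 2 ≤ 1 ∧
      560 ^ 4 * 4 ^ 4 * 2027025 * (dimE ρ₂ : ℝ) ^ 8 * (16 * (⌈β ^ θ⌉₊ : ℝ)) ^ 8 / β ^ 4 ≤ 1 := by
  obtain ⟨b₁, hb₁1, m₁⟩ := eventually_monomial_le_one (6 ^ 4 * 4 ^ 12 * 10395 * (dimE ρ₂ : ℝ) ^ 6 * 8 ^ 6) 6 hθ (a := -2)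
    (by push_cast; linarith)
  obtain ⟨b₂, -, m₂⟩ := eventually_monomial_le_one (560 ^ 4 * 4 ^ 4 * 2027025 * (dimE ρ₂ : ℝ) ^ 8 * 8 ^ 8) 8 hθ (a := -4)
    (by push_cast; linarith)
  refine ⟨max b₁ b₂, fun β hβ => ?_⟩
  have hβ1 : 1 ≤ β := hb₁1.trans ((le_max_left _ _).trans hβ)
  have hβ0 : 0 < β := by linarith
  obtain ⟨h16, -, -⟩ := boxSide_facts ⌈β ^ θ⌉₊
  have hH0 : (0 : ℝ) ≤ 16 * (⌈β ^ θ⌉₊ : ℝ) := by positivity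
  have hi2 : (β ^ 2)⁻¹ = β ^ (-2 : ℝ) := by rw [Real.rpow_neg hβ0.le, Real.rpow_two]
  have hi4 : (β ^ 4)⁻¹ = β ^ (-4 : ℝ) := by
    rw [Real.rpow_neg hβ0.le, show (4 : ℝ) = ((4 : ℕ) : ℝ) by norm_num, Real.rpow_natCast]
  have h6 : (16 * (⌈β ^ θ⌉₊ : ℝ)) ^ 6 ≤ 8 ^ 6 * (2 * (⌈β ^ θ⌉₊ : ℝ) + 3) ^ 6 := by
    rw [← mul_pow]; exact pow_le_pow_left₀ hH0 h16 6
  have h8 : (16 * (⌈β ^ θ⌉₊ : ℝ)) ^ 8 ≤ 8 ^ 8 * (2 * (⌈β ^ θ⌉₊ : ℝ) + 3) ^ 8 := by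
    rw [← mul_pow]; exact pow_le_pow_left₀ hH0 h16 8
  have k₁ := m₁ β ((le_max_left _ _).trans hβ)
  have k₂ := m₂ β ((le_max_right _ _).trans hβ)
  rw [← hi2] at k₁
  rw [← hi4] at k₂
  refine ⟨hβ1, ?_, ?_⟩
  · rw [div_eq_mul_inv]
    calc 6 ^ 4 * 4 ^ 12 * 10395 * (dimE ρ₂ : ℝ) ^ 6 * (16 * (⌈β ^ θ⌉₊ : ℝ)) ^ 6 * (β ^ 2)⁻¹
        ≤ 6 ^ 4 * 4 ^ 12 * 10395 * (dimE ρ₂ : ℝ) ^ 6 * (8 ^ 6 * (2 * (⌈β ^ θ⌉₊ : ℝ) + 3) ^ 6) * (β ^ 2)⁻¹ := by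
          gcongr
      _ = 6 ^ 4 * 4 ^ 12 * 10395 * (dimE ρ₂ : ℝ) ^ 6 * 8 ^ 6 * (2 * (⌈β ^ θ⌉₊ : ℝ) + 3) ^ 6 * (β ^ 2)⁻¹ := by ring
      _ ≤ 1 := k₁
  · rw [div_eq_mul_inv]
    calc 560 ^ 4 * 4 ^ 4 * 2027025 * (dimE ρ₂ : ℝ) ^ 8 * (16 * (⌈β ^ θ⌉₊ : ℝ)) ^ 8 * (β ^ 4)⁻¹
        ≤ 560 ^ 4 * 4 ^ 4 * 2027025 * (dimE ρ₂ : ℝ) ^ 8 * (8 ^ 8 * (2 * (⌈β ^ θ⌉₊ : ℝ) + 3) ^ 8) * (β ^ 4)⁻¹ := by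
          gcongr
      _ = 560 ^ 4 * 4 ^ 4 * 2027025 * (dimE ρ₂ : ℝ) ^ 8 * 8 ^ 8 * (2 * (⌈β ^ θ⌉₊ : ℝ) + 3) ^ 8 * (β ^ 4)⁻¹ := by ring
      _ ≤ 1 := k₂

/-! ## F(i): the fourth moments of the centred plaquette observables are `O(1)` -/

/-- The local cubic term of the plaquette `(x,1,2)` is continuous in `t`. -/
theorem continuous_localCubic {H : ℕ} (x : Literature.Probability.LatticeModels.Site 4) (β : ℝ) :
    Continuous fun t : TSpaceD H (dimE ρ₂) =>
      β * ((chartCubic ρ₂ (circV (extZero (unscaleTE H (dimE ρ₂) β t)) (x, 1, 2)) (extZero (unscaleTE H (dimE ρ₂) β t) (x, 1))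
            (extZero (unscaleTE H (dimE ρ₂) β t) (x + Pi.single 1 1, 2)) -
          chartCubic ρ₂ (circV (extZero (unscaleTE H (dimE ρ₂) β t)) (x, 1, 2)) (extZero (unscaleTE H (dimE ρ₂) β t) (x, 1))
            (extZero (unscaleTE H (dimE ρ₂) β t) (x + Pi.single 2 1, 1)) -
          chartCubic ρ₂ (circV (extZero (unscaleTE H (dimE ρ₂) β t)) (x, 1, 2)) (extZero (unscaleTE H (dimE ρ₂) β t) (x, 1))
            (extZero (unscaleTE H (dimE ρ₂) β t) (x, 2)) -
          chartCubic ρ₂ (circV (extZero (unscaleTE H (dimE ρ₂) β t)) (x, 1, 2)) (extZero (unscaleTE H (dimE ρ₂) β t) (x + Pi.single 1 1, 2))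
            (extZero (unscaleTE H (dimE ρ₂) β t) (x + Pi.single 2 1, 1)) -
          chartCubic ρ₂ (circV (extZero (unscaleTE H (dimE ρ₂) β t)) (x, 1, 2)) (extZero (unscaleTE H (dimE ρ₂) β t) (x + Pi.single 1 1, 2))
            (extZero (unscaleTE H (dimE ρ₂) β t) (x, 2)) +
          chartCubic ρ₂ (circV (extZero (unscaleTE H (dimE ρ₂) β t)) (x, 1, 2)) (extZero (unscaleTE H (dimE ρ₂) β t) (x + Pi.single 2 1, 1))
            (extZero (unscaleTE H (dimE ρ₂) β t) (x, 2))) / 2) := by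
  have hs := continuous_circV_extZero_unscaleTE (H := H) (dimE ρ₂) β (x, 1, 2)
  have h1 := continuous_extZero_unscaleTE (H := H) (dimE ρ₂) β (x, 1)
  have h2 := continuous_extZero_unscaleTE (H := H) (dimE ρ₂) β (x + Pi.single 1 1, 2)
  have h3 := continuous_extZero_unscaleTE (H := H) (dimE ρ₂) β (x + Pi.single 2 1, 1)
  have h4 := continuous_extZero_unscaleTE (H := H) (dimE ρ₂) β (x, 2)
  refine continuous_const.mul (Continuous.div_const ?_ _)
  exact (((((continuous_chartCubic₃ ρ₂ hs h1 h2).sub (continuous_chartCubic₃ ρ₂ hs h1 h3)).sub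
    (continuous_chartCubic₃ ρ₂ hs h1 h4)).sub (continuous_chartCubic₃ ρ₂ hs h2 h3)).sub
    (continuous_chartCubic₃ ρ₂ hs h2 h4)).add (continuous_chartCubic₃ ρ₂ hs h3 h4)

/-- **F(i) of LINE-17 — the fourth moment of a centred plaquette observable is `O(1)`**, uniformly over the plaquettes `(x,1,2)`
touching the cold box (in particular `obsF` and every `obsG T`, `T ≤ ⌈β^θ⌉`): for `0 < θ ≤ 1/16` there are `K, β₀` with
`(∫ (f_x − E_ν f_x)⁴ dν)^{1/4} ≤ K` for `β ≥ β₀`, `f_x = β·plaqCostAt ρ₂ x 1 2 ∘ cfgTE`.  Route: `(f − c)⁴ ≤ 8(f⁴ + c⁴)`, Jensen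
`c⁴ ≤ ∫f⁴dν` (`f` is bounded by `4β`); on the event `|f| ≤ |q| + |c_x| + r_x` (E(0)), so `f⁴ ≤ 27(q⁴ + c_x⁴ + r_x⁴)` `ν`-a.e.;
`∫·dν ≤ 2∫·dγ`; `∫q⁴dγ ≤ 840D⁴` (`integral_quadObs_pow_four_piD_le`, Dirichlet variance `≤ 1`), `∫c_x⁴, ∫r_x⁴ ≤ 1` eventually. -/
theorem gaussSide_fourthMoment {θ : ℝ} (hθ : 0 < θ) (hθ16 : θ ≤ 1 / 16) :
    ∃ K β₀ : ℝ, 0 ≤ K ∧ ∀ β : ℝ, β₀ ≤ β → ∀ x : Literature.Probability.LatticeModels.Site 4,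
      ((x, ⟨((1 : Fin 4), (2 : Fin 4)), by decide⟩) : ZdPlaquette 4) ∈ plaquettesTouching (AxialGauge.boxEdges 4 (2 * ⌈β ^ θ⌉₊ + 1)) →
      (∫ t, (β * plaqCostAt ρ₂ x 1 2 (cfgTE ρ₂ ⌈β ^ θ⌉₊ β t) -
          ∫ s, β * plaqCostAt ρ₂ x 1 2 (cfgTE ρ₂ ⌈β ^ θ⌉₊ β s) ∂(lineGauss θ β)) ^ 4 ∂(lineGauss θ β)) ^ (1 / 4 : ℝ) ≤ K := by
  haveI : SecondCountableTopology (Matrix (Fin 2) (Fin 2) ℂ) := inferInstanceAs (SecondCountableTopology (Fin 2 → Fin 2 → ℂ))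
  haveI : SecondCountableTopology SU2 := inferInstance
  have hρc : Continuous ρ₂ := continuous_fundamentalRep (Fin 2)
  have hinj : Function.Injective ρ₂ := fundamentalRep_injective (Fin 2)
  have hρu : ∀ g, ρ₂ g ∈ Matrix.unitaryGroup (Fin 2) ℂ := fundamentalRep_mem_unitaryGroup
  obtain ⟨β₁, hpack⟩ := eventually_lineGauss_package hθ hθ16 (k := 1) le_rfl
  obtain ⟨β₂, hthr⟩ := eventually_expClauseThresholds hθ hθ16 (r₂ := 1) (C₂ := 0) (K₁ := 0) one_pos le_rfl le_rfl
  obtain ⟨β₃, hthr4⟩ := eventually_fourthMomentThresholds hθ hθ16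
  refine ⟨16 * (54 * (840 * (dimE ρ₂ : ℝ) ^ 4 + 2)) + 1, max (max β₁ β₂) β₃, by positivity, fun β hβ x hx => ?_⟩
  obtain ⟨hβ1, hνP, hγS, -, -, hhalf⟩ := hpack β (le_trans (le_max_left _ _) ((le_max_left _ _).trans hβ))
  obtain ⟨-, hR4, -, -, -, -, -, -, -⟩ := hthr β (le_trans (le_max_right _ _) ((le_max_left _ _).trans hβ))
  obtain ⟨-, hc4, hr4⟩ := hthr4 β ((le_max_right _ _).trans hβ)
  have hβ0 : 0 < β := by linarith
  have hHr : (1 : ℝ) ≤ (⌈β ^ θ⌉₊ : ℝ) := (one_le_ceil_rpow_and_le hβ1 hθ.le).1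
  have hH : 1 ≤ ⌈β ^ θ⌉₊ := by exact_mod_cast hHr
  haveI : IsProbabilityMeasure (gaussD ⌈β ^ θ⌉₊ (dimE ρ₂)) := isProbabilityMeasure_gaussD _ _
  haveI : IsProbabilityMeasure (lineGauss θ β) := hνP
  have hSm : MeasurableSet (lineEvent θ β) := measurableSet_lineEvent θ β
  have hES : ∀ t ∈ lineEvent θ β, ∀ e, ‖unscaleTE ⌈β ^ θ⌉₊ (dimE ρ₂) β t e‖ ≤ 2 * etaOf β ⌈β ^ θ⌉₊ (epsOf θ) :=
    fun t ht e => ht.2 e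
  -- the observable is bounded by `4β`, measurable, hence in every `Lᵖ(ν)`
  have hfm : Measurable fun t : TSpaceD ⌈β ^ θ⌉₊ (dimE ρ₂) => β * plaqCostAt ρ₂ x 1 2 (cfgTE ρ₂ ⌈β ^ θ⌉₊ β t) :=
    ((measurable_plaqCostAt_of_continuous ρ₂ hρc x 1 2).comp (measurable_cfgTE ρ₂ hρc hinj β)).const_mul β
  have hfb : ∀ t : TSpaceD ⌈β ^ θ⌉₊ (dimE ρ₂), |β * plaqCostAt ρ₂ x 1 2 (cfgTE ρ₂ ⌈β ^ θ⌉₊ β t)| ≤ 4 * β := by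
    intro t
    rw [abs_mul, abs_of_pos hβ0]
    have h := abs_plaqCostAt_leG ρ₂ hρu x 1 2 (cfgTE ρ₂ ⌈β ^ θ⌉₊ β t)
    norm_num at h
    nlinarith
  have hfint : Integrable (fun t => β * plaqCostAt ρ₂ x 1 2 (cfgTE ρ₂ ⌈β ^ θ⌉₊ β t)) (lineGauss θ β) :=
    Integrable.of_bound hfm.aestronglyMeasurable (4 * β) (ae_of_all _ fun t => by rw [Real.norm_eq_abs]; exact hfb t)
  have hf4int : Integrable (fun t => (β * plaqCostAt ρ₂ x 1 2 (cfgTE ρ₂ ⌈β ^ θ⌉₊ β t)) ^ 4) (lineGauss θ β) := by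
    refine Integrable.of_bound (hfm.pow_const 4).aestronglyMeasurable ((4 * β) ^ 4) (ae_of_all _ fun t => ?_)
    rw [Real.norm_eq_abs, abs_pow]
    exact pow_le_pow_left₀ (abs_nonneg _) (hfb t) 4
  -- Jensen and the centring: `∫ (f − c)⁴ dν ≤ 16 ∫ f⁴ dν`
  have hJensen : (∫ t, β * plaqCostAt ρ₂ x 1 2 (cfgTE ρ₂ ⌈β ^ θ⌉₊ β t) ∂(lineGauss θ β)) ^ 4 ≤
      ∫ t, (β * plaqCostAt ρ₂ x 1 2 (cfgTE ρ₂ ⌈β ^ θ⌉₊ β t)) ^ 4 ∂(lineGauss θ β) :=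
    (Even.convexOn_pow (by decide : Even 4)).map_integral_le (continuousOn_pow 4) isClosed_univ
      (ae_of_all _ fun _ => Set.mem_univ _) hfint hf4int
  have hcentre : ∫ t, (β * plaqCostAt ρ₂ x 1 2 (cfgTE ρ₂ ⌈β ^ θ⌉₊ β t) -
      ∫ s, β * plaqCostAt ρ₂ x 1 2 (cfgTE ρ₂ ⌈β ^ θ⌉₊ β s) ∂(lineGauss θ β)) ^ 4 ∂(lineGauss θ β) ≤
      16 * ∫ t, (β * plaqCostAt ρ₂ x 1 2 (cfgTE ρ₂ ⌈β ^ θ⌉₊ β t)) ^ 4 ∂(lineGauss θ β) := by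
    have hpt : ∀ t, (β * plaqCostAt ρ₂ x 1 2 (cfgTE ρ₂ ⌈β ^ θ⌉₊ β t) -
        ∫ s, β * plaqCostAt ρ₂ x 1 2 (cfgTE ρ₂ ⌈β ^ θ⌉₊ β s) ∂(lineGauss θ β)) ^ 4 ≤
        8 * ((β * plaqCostAt ρ₂ x 1 2 (cfgTE ρ₂ ⌈β ^ θ⌉₊ β t)) ^ 4 +
          (∫ s, β * plaqCostAt ρ₂ x 1 2 (cfgTE ρ₂ ⌈β ^ θ⌉₊ β s) ∂(lineGauss θ β)) ^ 4) := fun t => Literature.Analysis.FunctionSpaces.pow_four_sub_le _ _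
    have hRint : Integrable (fun t => 8 * ((β * plaqCostAt ρ₂ x 1 2 (cfgTE ρ₂ ⌈β ^ θ⌉₊ β t)) ^ 4 +
        (∫ s, β * plaqCostAt ρ₂ x 1 2 (cfgTE ρ₂ ⌈β ^ θ⌉₊ β s) ∂(lineGauss θ β)) ^ 4)) (lineGauss θ β) :=
      (hf4int.add (integrable_const _)).const_mul _
    have hLint : Integrable (fun t => (β * plaqCostAt ρ₂ x 1 2 (cfgTE ρ₂ ⌈β ^ θ⌉₊ β t) -
        ∫ s, β * plaqCostAt ρ₂ x 1 2 (cfgTE ρ₂ ⌈β ^ θ⌉₊ β s) ∂(lineGauss θ β)) ^ 4) (lineGauss θ β) :=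
      Integrable.mono' hRint ((hfm.sub measurable_const).pow_const 4).aestronglyMeasurable
        (ae_of_all _ fun t => by rw [Real.norm_eq_abs, abs_of_nonneg (by positivity)]; exact hpt t)
    calc _ ≤ ∫ t, 8 * ((β * plaqCostAt ρ₂ x 1 2 (cfgTE ρ₂ ⌈β ^ θ⌉₊ β t)) ^ 4 +
          (∫ s, β * plaqCostAt ρ₂ x 1 2 (cfgTE ρ₂ ⌈β ^ θ⌉₊ β s) ∂(lineGauss θ β)) ^ 4) ∂(lineGauss θ β) := integral_mono hLint hRint hpt
      _ = 8 * ((∫ t, (β * plaqCostAt ρ₂ x 1 2 (cfgTE ρ₂ ⌈β ^ θ⌉₊ β t)) ^ 4 ∂(lineGauss θ β)) +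
          (∫ s, β * plaqCostAt ρ₂ x 1 2 (cfgTE ρ₂ ⌈β ^ θ⌉₊ β s) ∂(lineGauss θ β)) ^ 4) := by
          rw [integral_const_mul, integral_add hf4int (integrable_const _), integral_const, probReal_univ, one_smul]
      _ ≤ _ := by linarith [hJensen]
  -- local abbreviations (opaque): q = quadratic surrogate, c = local cubic term, r = quartic remainder of the plaquette
  obtain ⟨q, hq⟩ : ∃ q : TSpaceD ⌈β ^ θ⌉₊ (dimE ρ₂) → ℝ, q = fun t => qObsD ⌈β ^ θ⌉₊ (dimE ρ₂) (x, 1, 2) t := ⟨_, rfl⟩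
  obtain ⟨c, hc⟩ : ∃ c : TSpaceD ⌈β ^ θ⌉₊ (dimE ρ₂) → ℝ, c = fun t =>
      β * ((chartCubic ρ₂ (circV (extZero (unscaleTE ⌈β ^ θ⌉₊ (dimE ρ₂) β t)) (x, 1, 2)) (extZero (unscaleTE ⌈β ^ θ⌉₊ (dimE ρ₂) β t) (x, 1))
            (extZero (unscaleTE ⌈β ^ θ⌉₊ (dimE ρ₂) β t) (x + Pi.single 1 1, 2)) -
          chartCubic ρ₂ (circV (extZero (unscaleTE ⌈β ^ θ⌉₊ (dimE ρ₂) β t)) (x, 1, 2)) (extZero (unscaleTE ⌈β ^ θ⌉₊ (dimE ρ₂) β t) (x, 1))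
            (extZero (unscaleTE ⌈β ^ θ⌉₊ (dimE ρ₂) β t) (x + Pi.single 2 1, 1)) -
          chartCubic ρ₂ (circV (extZero (unscaleTE ⌈β ^ θ⌉₊ (dimE ρ₂) β t)) (x, 1, 2)) (extZero (unscaleTE ⌈β ^ θ⌉₊ (dimE ρ₂) β t) (x, 1))
            (extZero (unscaleTE ⌈β ^ θ⌉₊ (dimE ρ₂) β t) (x, 2)) -
          chartCubic ρ₂ (circV (extZero (unscaleTE ⌈β ^ θ⌉₊ (dimE ρ₂) β t)) (x, 1, 2)) (extZero (unscaleTE ⌈β ^ θ⌉₊ (dimE ρ₂) β t) (x + Pi.single 1 1, 2))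
            (extZero (unscaleTE ⌈β ^ θ⌉₊ (dimE ρ₂) β t) (x + Pi.single 2 1, 1)) -
          chartCubic ρ₂ (circV (extZero (unscaleTE ⌈β ^ θ⌉₊ (dimE ρ₂) β t)) (x, 1, 2)) (extZero (unscaleTE ⌈β ^ θ⌉₊ (dimE ρ₂) β t) (x + Pi.single 1 1, 2))
            (extZero (unscaleTE ⌈β ^ θ⌉₊ (dimE ρ₂) β t) (x, 2)) +
          chartCubic ρ₂ (circV (extZero (unscaleTE ⌈β ^ θ⌉₊ (dimE ρ₂) β t)) (x, 1, 2)) (extZero (unscaleTE ⌈β ^ θ⌉₊ (dimE ρ₂) β t) (x + Pi.single 2 1, 1))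
            (extZero (unscaleTE ⌈β ^ θ⌉₊ (dimE ρ₂) β t) (x, 2))) / 2) := ⟨_, rfl⟩
  obtain ⟨r, hr⟩ : ∃ r : TSpaceD ⌈β ^ θ⌉₊ (dimE ρ₂) → ℝ, r = fun t => 560 * β * (‖extZero (unscaleTE ⌈β ^ θ⌉₊ (dimE ρ₂) β t) (x, 1)‖ ^ 4 +
      ‖extZero (unscaleTE ⌈β ^ θ⌉₊ (dimE ρ₂) β t) (x + Pi.single 1 1, 2)‖ ^ 4 + ‖extZero (unscaleTE ⌈β ^ θ⌉₊ (dimE ρ₂) β t) (x + Pi.single 2 1, 1)‖ ^ 4 +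
      ‖extZero (unscaleTE ⌈β ^ θ⌉₊ (dimE ρ₂) β t) (x, 2)‖ ^ 4) := ⟨_, rfl⟩
  -- Gaussian fourth moments: `∫q⁴ ≤ 840D⁴`, `∫c⁴ ≤ 1`, `∫r⁴ ≤ 1`
  have hq4 := integral_quadObs_pow_four_piD_le (H := ⌈β ^ θ⌉₊) (D := dimE ρ₂) (fun _ => (0 : ℝ)) ((x, 1, 2) : Plaq 4)
  simp only [zero_add, zero_pow (by norm_num : 8 ≠ 0)] at hq4
  obtain ⟨hq4I, hq4le⟩ := hq4
  have hK1 : boxDirProjKernel ⌈β ^ θ⌉₊ ((x, 1, 2) : Plaq 4) (x, 1, 2) ≤ 1 := by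
    have h := integral_dirCirc_sq_le_one_of_touching (H := ⌈β ^ θ⌉₊) hx
    rw [integral_dirCirc_sq] at h; exact h
  have hK0 : 0 ≤ boxDirProjKernel ⌈β ^ θ⌉₊ ((x, 1, 2) : Plaq 4) (x, 1, 2) := boxDirProjKernel_self_nonneg _
  have hqI : Integrable (fun t => q t ^ 4) (gaussD ⌈β ^ θ⌉₊ (dimE ρ₂)) := by rw [hq]; exact hq4I
  have hqle : ∫ t, q t ^ 4 ∂(gaussD ⌈β ^ θ⌉₊ (dimE ρ₂)) ≤ 840 * (dimE ρ₂ : ℝ) ^ 4 := by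
    rw [hq]
    refine hq4le.trans ?_
    rw [Finset.sum_const, Finset.card_univ, Fintype.card_fin, nsmul_eq_mul]
    have hK4 : boxDirProjKernel ⌈β ^ θ⌉₊ ((x, 1, 2) : Plaq 4) (x, 1, 2) ^ 4 ≤ 1 := pow_le_one₀ hK0 hK1
    have hD0 : (0 : ℝ) ≤ (dimE ρ₂ : ℝ) := Nat.cast_nonneg _
    nlinarith [pow_nonneg hD0 3, pow_nonneg hD0 4, mul_nonneg (pow_nonneg hD0 4) (sub_nonneg.2 hK4)]
  have hcm : AEStronglyMeasurable c (gaussD ⌈β ^ θ⌉₊ (dimE ρ₂)) := by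
    rw [hc]; exact (continuous_localCubic (H := ⌈β ^ θ⌉₊) x β).measurable.aestronglyMeasurable
  have hcb : ∀ t, |c t| ≤ 6 * β * (‖extZero (unscaleTE ⌈β ^ θ⌉₊ (dimE ρ₂) β t) (x, 1)‖ +
      ‖extZero (unscaleTE ⌈β ^ θ⌉₊ (dimE ρ₂) β t) (x + Pi.single 1 1, 2)‖ + ‖extZero (unscaleTE ⌈β ^ θ⌉₊ (dimE ρ₂) β t) (x + Pi.single 2 1, 1)‖ +
      ‖extZero (unscaleTE ⌈β ^ θ⌉₊ (dimE ρ₂) β t) (x, 2)‖) ^ 3 := fun t => by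
    rw [hc]; exact abs_localCubic_le ρ₂ hβ0.le (extZero (unscaleTE ⌈β ^ θ⌉₊ (dimE ρ₂) β t)) x 1 2
  obtain ⟨hcI, hc4le⟩ := integral_pow_four_le_of_cubic_leg_bound (D := dimE ρ₂) hH hβ0 x 1 2 hcm hcb
  have hcle : ∫ t, c t ^ 4 ∂(gaussD ⌈β ^ θ⌉₊ (dimE ρ₂)) ≤ 1 := hc4le.trans hc4
  obtain ⟨-, hrI', hr4le⟩ := integral_remainder_moments_le (H := ⌈β ^ θ⌉₊) (D := dimE ρ₂) hH hβ0 x 1 2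
  have hrI : Integrable (fun t => r t ^ 4) (gaussD ⌈β ^ θ⌉₊ (dimE ρ₂)) := by rw [hr]; exact hrI'
  have hrle : ∫ t, r t ^ 4 ∂(gaussD ⌈β ^ θ⌉₊ (dimE ρ₂)) ≤ 1 := by rw [hr]; exact hr4le.trans hr4
  have hr0 : ∀ t, 0 ≤ r t := fun t => by
    rw [hr]
    exact mul_nonneg (mul_nonneg (by norm_num) hβ0.le) (add_nonneg (add_nonneg (add_nonneg (pow_nonneg (norm_nonneg _) 4)
      (pow_nonneg (norm_nonneg _) 4)) (pow_nonneg (norm_nonneg _) 4)) (pow_nonneg (norm_nonneg _) 4))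
  -- the dominating function `G = 27(q⁴ + c⁴ + r⁴)` under `γ` and `ν`
  have hGγ : Integrable (fun t => 27 * (q t ^ 4 + c t ^ 4 + r t ^ 4)) (gaussD ⌈β ^ θ⌉₊ (dimE ρ₂)) :=
    ((hqI.add hcI).add hrI).const_mul _
  have hGν : Integrable (fun t => 27 * (q t ^ 4 + c t ^ 4 + r t ^ 4)) (lineGauss θ β) := integrable_cond_of_integrable hγS hGγ
  have hG0 : ∀ t, 0 ≤ 27 * (q t ^ 4 + c t ^ 4 + r t ^ 4) := fun t =>
    mul_nonneg (by norm_num) (add_nonneg (add_nonneg (Even.pow_nonneg (by decide) _) (Even.pow_nonneg (by decide) _))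
      (Even.pow_nonneg (by decide) _))
  -- `f⁴ ≤ G` on the event (E(0): `|q − f − c| ≤ r`)
  have hdec : ∀ t ∈ lineEvent θ β, (β * plaqCostAt ρ₂ x 1 2 (cfgTE ρ₂ ⌈β ^ θ⌉₊ β t)) ^ 4 ≤ 27 * (q t ^ 4 + c t ^ 4 + r t ^ 4) := by
    intro t ht
    have h4 : ∀ e, ‖unscaleTE ⌈β ^ θ⌉₊ (dimE ρ₂) β t e‖ ≤ 1 / 4 := fun e => (hES t ht e).trans hR4
    have h0 : |q t - β * plaqCostAt ρ₂ x 1 2 (cfgTE ρ₂ ⌈β ^ θ⌉₊ β t) - c t| ≤ r t := by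
      rw [hq, hc, hr]; exact abs_qObsD_sub_beta_mul_plaqCostAt_sub_cubic_le ρ₂ hρc hβ0 t h4 x 1 2
    have htri : |β * plaqCostAt ρ₂ x 1 2 (cfgTE ρ₂ ⌈β ^ θ⌉₊ β t)| ≤ |q t| + |c t| + r t := by
      rw [abs_le] at h0 ⊢
      constructor <;> cases abs_cases (q t) <;> cases abs_cases (c t) <;> linarith
    have h27 := add_add_pow_four_le (abs_nonneg (q t)) (abs_nonneg (c t)) (hr0 t)
    have e4 : Even 4 := by decide
    rw [e4.pow_abs, e4.pow_abs] at h27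
    calc (β * plaqCostAt ρ₂ x 1 2 (cfgTE ρ₂ ⌈β ^ θ⌉₊ β t)) ^ 4 = |β * plaqCostAt ρ₂ x 1 2 (cfgTE ρ₂ ⌈β ^ θ⌉₊ β t)| ^ 4 :=
          (e4.pow_abs _).symm
      _ ≤ (|q t| + |c t| + r t) ^ 4 := pow_le_pow_left₀ (abs_nonneg _) htri 4
      _ ≤ _ := h27
  -- integrate: `∫ f⁴ dν ≤ ∫ G dν ≤ 2 ∫ G dγ ≤ 54·(840 D⁴ + 2)`
  have haeE : ∀ᵐ t ∂(lineGauss θ β), t ∈ lineEvent θ β := ae_mem_lineEvent θ β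
  have hf4le : ∫ t, (β * plaqCostAt ρ₂ x 1 2 (cfgTE ρ₂ ⌈β ^ θ⌉₊ β t)) ^ 4 ∂(lineGauss θ β) ≤ 54 * (840 * (dimE ρ₂ : ℝ) ^ 4 + 2) := by
    have h1 := integral_mono_ae hf4int hGν (haeE.mono fun t ht => hdec t ht)
    have h2 := integral_cond_le_two_mul (μ := gaussD ⌈β ^ θ⌉₊ (dimE ρ₂)) (E := lineEvent θ β) hhalf (ae_of_all _ hG0) hGγ
    have h3 : ∫ t, 27 * (q t ^ 4 + c t ^ 4 + r t ^ 4) ∂(gaussD ⌈β ^ θ⌉₊ (dimE ρ₂)) =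
        27 * ((∫ t, q t ^ 4 ∂(gaussD ⌈β ^ θ⌉₊ (dimE ρ₂))) + (∫ t, c t ^ 4 ∂(gaussD ⌈β ^ θ⌉₊ (dimE ρ₂))) +
          ∫ t, r t ^ 4 ∂(gaussD ⌈β ^ θ⌉₊ (dimE ρ₂))) := by
      have hqcI : Integrable (fun t => q t ^ 4 + c t ^ 4) (gaussD ⌈β ^ θ⌉₊ (dimE ρ₂)) := hqI.add hcI
      rw [integral_const_mul, integral_add hqcI hrI, integral_add hqI hcI]
    have h2' : ∫ t, 27 * (q t ^ 4 + c t ^ 4 + r t ^ 4) ∂(lineGauss θ β) ≤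
        2 * ∫ t, 27 * (q t ^ 4 + c t ^ 4 + r t ^ 4) ∂(gaussD ⌈β ^ θ⌉₊ (dimE ρ₂)) := h2
    linarith [h1, h2', h3, hqle, hcle, hrle]
  -- conclude
  have hM0 : 0 ≤ ∫ t, (β * plaqCostAt ρ₂ x 1 2 (cfgTE ρ₂ ⌈β ^ θ⌉₊ β t) -
      ∫ s, β * plaqCostAt ρ₂ x 1 2 (cfgTE ρ₂ ⌈β ^ θ⌉₊ β s) ∂(lineGauss θ β)) ^ 4 ∂(lineGauss θ β) :=
    integral_nonneg fun t => Even.pow_nonneg (by decide) _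
  calc _ ≤ (∫ t, (β * plaqCostAt ρ₂ x 1 2 (cfgTE ρ₂ ⌈β ^ θ⌉₊ β t) -
        ∫ s, β * plaqCostAt ρ₂ x 1 2 (cfgTE ρ₂ ⌈β ^ θ⌉₊ β s) ∂(lineGauss θ β)) ^ 4 ∂(lineGauss θ β)) + 1 := rpow_quarter_le_add_one hM0
    _ ≤ 16 * (54 * (840 * (dimE ρ₂ : ℝ) ^ 4 + 2)) + 1 := by linarith [hcentre, hf4le]

end Summit.QuantumFields.YangMills.Theorems.AllWindowsColdBoxBoxMidLine

end
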